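import Literature.AlgebraicGeometry.Frobenioids.ModelFrobenioidStandardProofs
import Literature.AlgebraicGeometry.Frobenioids.PadicFrobenioidIsFrobenioid
import Literature.AlgebraicGeometry.Frobenioids.PadicFrobenioidMonoidData
import Literature.AlgebraicGeometry.Frobenioids.PadicFrobenioidIsotropic
import Literature.AlgebraicGeometry.Frobenioids.ModelFrobenioidBiratNormalized
import Literature.AlgebraicGeometry.Frobenioids.ModelFrobenioidBaseSection
import Literature.AlgebraicGeometry.Frobenioids.CoAngularPreSteps
import HarnessLib

/-!
# Frobenioids II, Theorem 1.2 (i), third sentence: the `p`-adic Frobenioid is of standard type — PROOF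

Mochizuki, *The geometry of Frobenioids II*, Kyushu J. Math. **62** (2008) 401–460, §1, Theorem 1.2 (i),
third sentence, p. 9 [cite: MochizukiFrdII2008, Thm 1.2 (i) p.9]: "If `D` is of FSMFF-type, then `C` is of
rationally standard type" — whose STANDARD-TYPE half ([FrdI] Def. 4.5 (iii): rationally standard =
rational + standard + a Frobenius-compact object of `(C^un-tr)^birat`) is, by the printed proof,
"[FrdI], Theorem 5.2, (iii)" applied to the `p`-adic Frobenioid datum.

PROOF-ONLY file (seat abc-iut-L1-d10; node `FrdII:Thm1.2(i)`, third sentence, STANDARD-TYPE HALF) in the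
tree's canonical vocabulary: abc-iut-L1-t3's Def. 3.1 (i) `PreFrobenioidData.IsOfStandardType` applied
to abc-iut-L1-t2's operations `ModelFrobenioid.data d.Φ d.B d.divB` of the `p`-adic Frobenioid
`C = d.frobenioid` (abc-iut-L1-t4's schema `Thm12_i_standard d V`, which quantifies over a free slot
`V.IsOfRationallyStandardType`, is not touched). Inputs of [FrdI] Thm. 5.2 (iii)
(`ModelFrobenioid.standardTypeIff_holds`, abc-iut-L1-t2): (a) "`Φ` zero ⇒ Frobenius-compact object" is
vacuous (`Datum.not_isZeroMonoid`); (b) `D` of FSMFF-type is the hypothesis; (c) `Φ` non-dilating holds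
unconditionally (`Datum.isNonDilatingOn`: `End_D(A_D)` acts trivially on `Φ(A_D)`, FrdII p. 9); the
standing hypotheses of Thm. 5.2 (`ModelFrobenioid.Hypotheses`: `Φ`, `B` monoids on `D` — t4's
`d.IsMonoidData`, automatic over FSM-type bases; `Φ` divisorial — monoprime; `B` group-like;
`D` connected, totally epimorphic) are `Datum.hypotheses_of_isMonoidData`.
RESULTS: `thm12_isOfStandardType (h : d.IsMonoidData) (hD : IsOfFSMFFType D)` and, premise-free over a
base of FSM-type (⇒ FSMFF-type, [FrdI] §0 p. 18), `thm12_isOfStandardType_of_isOfFSMType`.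
v2 (append-only) adds the "model type" clause of Thm. 1.2 (i) in [FrdI] Def. 4.5 (i) form: the
birationally-Frobenius-normalized half at THE birationalization (`thm12_isOfBiratFrobeniusNormalizedType`,
via [FrdI] Thm. 5.2 (ii) `ModelFrobenioid.isOfBiratFrobeniusNormalizedType`) and the pre-model half for a
skeletal base (`thm12_isOfPreModelType`, abc-iut-found's `ModelFrobenioid.isOfPreModelType`).
No definitions; nothing here bears on [IUTchIII].
-/

namespace Literature.AlgebraicGeometry.Frobenioids

open CategoryTheory Opposite Function

universe v u

namespace PadicFrd

namespace Datum

variable {D : Type u} [Category.{v} D] {p : ℕ} [Fact p.Prime] (d : Datum D p)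

/-- The standing hypotheses of [FrdI] Thm. 5.2 hold for the datum of a `p`-adic Frobenioid with `Φ`, `B`
monoids on `D`: `Φ` is divisorial (monoprime, abc-iut-L1-d8's `IsMonoprime.isDivisorial`), `B` is
group-like (`Datum.isGroupLike_B`), `D` is connected and totally epimorphic (datum fields).
[cite: MochizukiFrdII2008, Ex 1.1 (ii) p.8] -/
theorem hypotheses_of_isMonoidData (h : d.IsMonoidData) : ModelFrobenioid.Hypotheses d.Φ d.B where
  isMonoidOn := h.1
  isDivisorial := fun A => (d.isMonoprime (op A)).isDivisorial
  isMonoidOn_rat := h.2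
  isGroupLike_rat := d.objectwise_isGroupLike_B
  isGraphConnected := isGraphConnected_iff_isConnected.mpr d.isConnected_base
  isTotallyEpimorphic := d.isTotallyEpimorphic_base

/-- **Thm. 1.2 (i)**, third sentence, STANDARD-TYPE half DISCHARGED: if `D` is of FSMFF-type (and `Φ`,
`B` are monoids on `D`), the `p`-adic Frobenioid `C` is of standard type ([FrdI] Def. 3.1 (i)) — by
[FrdI] Thm. 5.2 (iii): (a) vacuous since `Φ ≠ 0`, (b) given, (c) `Φ` non-dilating.
[cite: MochizukiFrdII2008, Thm 1.2 (i) p.9] -/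
theorem thm12_isOfStandardType (h : d.IsMonoidData) (hD : IsOfFSMFFType D) :
    (ModelFrobenioid.data d.Φ d.B d.divB).IsOfStandardType :=
  (ModelFrobenioid.standardTypeIff_holds d.Φ d.B d.divB (d.hypotheses_of_isMonoidData h)).mpr
    ⟨fun h0 => (d.not_isZeroMonoid h0).elim, hD, d.isNonDilatingOn⟩

/-- **Thm. 1.2 (i)**, third sentence, STANDARD-TYPE half over a base of FSM-type, PREMISE-FREE: every
`p`-adic Frobenioid over a connected, totally epimorphic base `D` of FSM-type (e.g. `D = D₀`, or
`B^temp(Π, Π°)⁰` of Ex. 1.3 (i)) is of standard type. [cite: MochizukiFrdII2008, Thm 1.2 (i) p.9] -/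
theorem thm12_isOfStandardType_of_isOfFSMType (hD : IsOfFSMType D) :
    (ModelFrobenioid.data d.Φ d.B d.divB).IsOfStandardType :=
  d.thm12_isOfStandardType (d.isMonoidData_of_isOfFSMType hD) hD.isOfFSMFFType

/-- **Example 1.1 (ii)** over a base of FSM-type, PREMISE-FREE: the `p`-adic Frobenioid `C → F_Φ` IS a
Frobenioid ([FrdI] Thm. 5.2 (ii) via abc-iut-L1-d8's `isFrobenioid_of_isMonoidData`, the monoid-data
premise being automatic, `isMonoidData_of_isOfFSMType`). [cite: MochizukiFrdII2008, Ex 1.1 (ii) p.8] -/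
theorem isFrobenioid_of_isOfFSMType (hD : IsOfFSMType D) :
    PreFrobenioid.IsFrobenioid d.structureFunctor :=
  d.isFrobenioid_of_isMonoidData (d.isMonoidData_of_isOfFSMType hD)


/-! ### Theorem 1.2 (i): "of … model … type" — the two halves of [FrdI] Def. 4.5 (i) / Thm. 5.2 (ii) -/

/-- The square-completion property of [FrdI] Prop. 1.11 (vii) for the `p`-adic Frobenioid (input `hsq` of
the birationalization `C^birat`), from abc-iut-L1-t1's `exists_coAngular_square`, given that `C → F_Φ` is a
Frobenioid. [cite: MochizukiFrdII2008, Ex 1.1 (ii) p.8] -/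
theorem hasBiratSquares (hF : PreFrobenioid.IsFrobenioid d.structureFunctor) :
    PreFrobenioid.HasBiratSquares d.structureFunctor :=
  fun _ _ _ φ β hβ => PreFrobenioid.exists_coAngular_square hF β hβ φ

/-- **Thm. 1.2 (i)**, "model type", BIRATIONALLY FROBENIUS-NORMALIZED half ([FrdI] Def. 4.5 (i)): every
object of the `p`-adic Frobenioid is birationally Frobenius-normalized with respect to THE
birationalization `C^birat` (`PreFrobenioid.biratData`, seats abc-iut-L6-t8/L6-t6), by [FrdI] Thm. 5.2 (ii)
(`ModelFrobenioid.isOfBiratFrobeniusNormalizedType`), given that `Φ`, `B` are monoids on `D`.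
[cite: MochizukiFrdII2008, Thm 1.2 (i) p.9] -/
theorem thm12_isOfBiratFrobeniusNormalizedType (h : d.IsMonoidData)
    (hsq : PreFrobenioid.HasBiratSquares d.structureFunctor) :
    PreFrobenioidData.IsOfBiratFrobeniusNormalizedType
      (PreFrobenioid.biratData (d.isFrobenioid_of_isMonoidData h) hsq) :=
  ModelFrobenioid.isOfBiratFrobeniusNormalizedType_of_isDivisorial _ hsq
    (fun A => (d.isMonoprime (op A)).isDivisorial) d.objectwise_isGroupLike_B

/-- **Thm. 1.2 (i)**, "model type", birationally Frobenius-normalized half over a base of FSM-type,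
PREMISE-FREE up to the choice of `hsq` (e.g. `d.hasBiratSquares _`). [cite: MochizukiFrdII2008, Thm 1.2 (i) p.9] -/
theorem thm12_isOfBiratFrobeniusNormalizedType_of_isOfFSMType (hD : IsOfFSMType D)
    (hsq : PreFrobenioid.HasBiratSquares d.structureFunctor) :
    PreFrobenioidData.IsOfBiratFrobeniusNormalizedType
      (PreFrobenioid.biratData (d.isFrobenioid_of_isOfFSMType hD) hsq) :=
  d.thm12_isOfBiratFrobeniusNormalizedType (d.isMonoidData_of_isOfFSMType hD) hsq

/-- **Thm. 1.2 (i)**, "model type", PRE-MODEL half ([FrdI] Def. 2.7 (iii), abc-iut-L1-t2's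
`PreFrobenioid.IsOfPreModelType`): for a SKELETAL base `D` the `p`-adic Frobenioid is of pre-model type —
abc-iut-found's [FrdI] Thm. 5.2 (ii) `ModelFrobenioid.isOfPreModelType` (zero section + zero Frobenius
section, Def. 2.7 (i)(a) read for `D` skeletal). [cite: MochizukiFrdII2008, Thm 1.2 (i) p.9] -/
theorem thm12_isOfPreModelType (hD : Skeletal D) :
    PreFrobenioid.IsOfPreModelType d.structureFunctor :=
  ModelFrobenioid.isOfPreModelType (fun A => (d.isMonoprime (op A)).isDivisorial)
    d.objectwise_isGroupLike_B hD

end Datum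

end PadicFrd

end Literature.AlgebraicGeometry.Frobenioids
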